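import Mathlib.Algebra.BigOperators.Intervals
import Mathlib.Algebra.Group.Subgroup.Finite
import Mathlib.Algebra.Group.Submonoid.BigOperators
import Mathlib.Algebra.Module.BigOperators
import Mathlib.Algebra.Module.NatInt
import Mathlib.Tactic.Abel
import Mathlib.Tactic.Ring
import HarnessLib

/-!
# Norm-zero points with prescribed component: the algebraic skeleton (torus-valued reduction,
# torsion lifts, and the Frobenius norm on an unramified layer)

`Proofs` file (theorems only, no definitions, no named facts) in topic
`NumberTheory/EllipticCurves`; third bottom-up step (after `UnramifiedLayerTorusNormProofs`,
`TateNormalFormUnramifiedComponentsProofs`) of the arithmetic half of the named fact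
`Literature.Barriers.BirchSwinnertonDyer.Matsuno2009_lemma41_local` (K. Matsuno, Math. Res.
Lett. **16** (2009), Lemma 4.1: `H¹(Gal(L/ℚ_ℓ), E(L))` has an element of order `n` for `E`
split multiplicative, `L/ℚ_ℓ` unramified of degree `f`, `n ∣ f`, `n ∣ c_ℓ`, `ℓ ∤ n`).  After the
group cohomology of `DescentDefectUnboundedMatsunoLemma41CyclicProofs` what is needed is a point
`m ∈ E(L)` of norm zero, `Σ_{j<f} Fʲ m = O`, congruent modulo `E₀(L)` to a given `ℚ_ℓ`-rational
point `P₀` whose class in `E(ℚ_ℓ)/E₀(ℚ_ℓ) ≅ ℤ/c` has order `n` (so `n P₀ ∈ E₀`).  The printed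
proof gets this from the cohomological triviality of `E₀(L)` (Mazur 1972, Prop. 4.3); here it is
obtained instead by a **torsion argument on the split torus**, whose purely algebraic skeleton
this file isolates and proves, for:

an abelian group `M` (the points `E(K̄_v)`), an endomorphism `F` (the Frobenius), subgroups
`E0` (points with nonsingular reduction), `L1` (points over the layer `L`, on which `Fᶠ = 1`) and
`K1 ≤ E0` (the kernel of reduction), a homomorphism `ρ : E0 → A` to an abelian group (the
reduction onto the torus `E₀/E₁ ≅ k̄^×`, written additively) with kernel `K1` and `ρ ∘ F = q ρ`
(the Frobenius is the `q`-th power on the torus), and a class `IsGood` of natural numbers (those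
prime to the residue characteristic) for which `K1 ∩ L1` is divisible and `K1` has no torsion:

* `exists_torsion_lift` (**C1**): every `s ∈ A` with `(q^f - 1) s = 0` (a torus value in
  `𝔽_{q^f}^×`) is `ρ Q` for a point `Q ∈ E0 ∩ L1` with `(q^f - 1) Q = 0` — lift to `E0 ∩ L1`
  (hypothesis `hlift`: Hensel), then kill the discrepancy in `K1` by dividing (`hdiv`);
* `exists_nsmul_eq_zero_sub_mem` (**C2**): if `n ∣ f`, every `F`-fixed `P₀ ∈ L1` with
  `n P₀ ∈ E0` is congruent modulo `E0 ∩ L1` to an **`n`-torsion point `P' ∈ L1`** — because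
  `t = ρ(n P₀)` satisfies `q t = t`, hence is `n s` with `(q^f - 1) s = 0` (hypothesis `hR1`, the
  finite-field fact `𝔽_q^× ⊆ (𝔽_{q^f}^×)^n` of `UnramifiedLayerTorusNormProofs`), `s` lifts to
  `U ∈ E0 ∩ L1`, and `n U - n P₀ ∈ K1 ∩ L1` is `n e`, so `P' = P₀ - (U - e)` works;
* `exists_sum_pow_apply_eq_zero_sub_mem` (**C3, main**): under the same hypotheses there is
  `m ∈ L1` with **`Σ_{j<f} Fʲ m = 0` and `m - P₀ ∈ E0`**: with `P'` as in (C2), the norm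
  `T = Σ_{j<f} Fʲ P'` lies in `E0` (`T - f P₀ ∈ E0`, `f P₀ = (f/n)(n P₀)`), is `F`-fixed and
  `n`-torsion, so `ρ T = t'` has `q t' = t'`, `n t' = 0`; by the norm-surjectivity `hR2`
  (`μ_{q^f-1} ↠ μ_{q-1}`, `UnramifiedLayerTorusNormProofs`) `t' = Σ_{j<f} qʲ u` with
  `(q^f - 1) u = 0`; the torsion lift `Q` of `u` (C1) has `ρ(Σ Fʲ Q) = Σ qʲ u = ρ T`, so
  `Σ Fʲ Q - T ∈ K1` is killed by the good number `(q^f - 1) n`, hence vanishes (`htors`), and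
  `m = P' - Q` has norm `T - Σ Fʲ Q = 0`.

The instantiation (points of the Tate normal form over `K̄_v`, `F` an arithmetic Frobenius,
`L1` the points over `K_v(ζ_{q^f-1})`, `ρ` Silverman's node map after reduction) is the sibling
`TateNormalFormLayerNormZeroProofs` (to follow).

## References

* [Matsuno2009] K. Matsuno, Math. Res. Lett. 16 (2009), 449–461, Lemma 4.1 and its proof.
* [Mazur1972] B. Mazur, *Rational points of abelian varieties with values in towers of number
  fields*, Invent. Math. 18 (1972), Prop. 4.3 (the cohomological input replaced here).
* [SerreLocalFields1979] J.-P. Serre, *Local Fields*, V §2, XIII §1.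

## Design

Pure algebra, no definitions; `F : AddMonoid.End M` with its monoid powers `F ^ j`; the torus is
an arbitrary additive abelian group `A` (`Additive k̄ˣ` in the application); all arithmetic
inputs are hypotheses named as in the list above.  Namespace
`Literature.NumberTheory.EllipticCurves.NormZeroSkeleton`.
-/

namespace Literature.NumberTheory.EllipticCurves.NormZeroSkeleton

open Finset

variable {M : Type*} [AddCommGroup M] {A : Type*} [AddCommGroup A]
  {F : AddMonoid.End M} {E0 L1 K1 : AddSubgroup M} {ρ : E0 →+ A} {q f : ℕ}

/-! ### Iterates of `F` -/

/-- `F^{j+1} P = F (Fʲ P)` for an additive endomorphism. [folklore] -/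
theorem pow_succ_apply (F : AddMonoid.End M) (j : ℕ) (P : M) :
    (F ^ (j + 1)) P = F ((F ^ j) P) := by
  rw [pow_succ']
  rfl

/-- `F⁰ P = P`. [folklore] -/
theorem pow_zero_apply (F : AddMonoid.End M) (P : M) : (F ^ 0) P = P := by
  rw [pow_zero]
  rfl

/-- `F`-stable subgroups are stable under the powers of `F`. [folklore] -/
theorem pow_apply_mem {S : AddSubgroup M} (hS : ∀ P ∈ S, F P ∈ S) (j : ℕ) {P : M} (hP : P ∈ S) :
    (F ^ j) P ∈ S := by
  induction j with
  | zero => rw [pow_zero_apply]; exact hP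
  | succ j ih => rw [pow_succ_apply]; exact hS _ ih

/-- `ρ (Fʲ P) = qʲ ρ P` from `ρ (F P) = q ρ P`. [folklore] -/
theorem rho_pow_apply (hFE : ∀ P ∈ E0, F P ∈ E0)
    (hρF : ∀ (P : M) (hP : P ∈ E0), ρ ⟨F P, hFE P hP⟩ = q • ρ ⟨P, hP⟩) (j : ℕ) (P : M)
    (hP : P ∈ E0) : ρ ⟨(F ^ j) P, pow_apply_mem hFE j hP⟩ = q ^ j • ρ ⟨P, hP⟩ := by
  induction j with
  | zero =>
    have e : (⟨(F ^ 0) P, pow_apply_mem hFE 0 hP⟩ : E0) = ⟨P, hP⟩ :=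
      Subtype.ext (pow_zero_apply F P)
    rw [e, pow_zero, one_smul]
  | succ j ih =>
    have e : (⟨(F ^ (j + 1)) P, pow_apply_mem hFE (j + 1) hP⟩ : E0) =
        ⟨F ((F ^ j) P), hFE _ (pow_apply_mem hFE j hP)⟩ :=
      Subtype.ext (pow_succ_apply F j P)
    rw [e, hρF _ (pow_apply_mem hFE j hP), ih, smul_smul, pow_succ']

/-- **The norm of a layer element is `F`-fixed**: if `Fᶠ P = P` then
`F (Σ_{j<f} Fʲ P) = Σ_{j<f} Fʲ P`. [folklore] -/
theorem apply_sum_pow_apply_eq {P : M} (hFf : (F ^ f) P = P) :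
    F (∑ j ∈ range f, (F ^ j) P) = ∑ j ∈ range f, (F ^ j) P := by
  rw [map_sum]
  have h1 : ∑ j ∈ range f, F ((F ^ j) P) = ∑ j ∈ range f, (F ^ (j + 1)) P :=
    sum_congr rfl fun j _ ↦ by rw [pow_succ_apply]
  rw [h1]
  rcases Nat.eq_zero_or_pos f with rfl | hf
  · simp
  · obtain ⟨g, rfl⟩ : ∃ g, f = g + 1 := ⟨f - 1, by omega⟩
    rw [sum_range_succ (fun j ↦ (F ^ (j + 1)) P), hFf,
      sum_range_succ' (fun j ↦ (F ^ j) P), pow_zero_apply]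

/-- Norms of sums and of multiples: `Σ Fʲ` is additive. [folklore] -/
theorem sum_pow_apply_sub (P Q : M) :
    ∑ j ∈ range f, (F ^ j) (P - Q) = ∑ j ∈ range f, (F ^ j) P - ∑ j ∈ range f, (F ^ j) Q := by
  rw [← sum_sub_distrib]
  exact sum_congr rfl fun j _ ↦ map_sub _ _ _

/-- `Σ Fʲ (N P) = N Σ Fʲ P`. [folklore] -/
theorem sum_pow_apply_nsmul (N : ℕ) (P : M) :
    ∑ j ∈ range f, (F ^ j) (N • P) = N • ∑ j ∈ range f, (F ^ j) P := by
  rw [Finset.smul_sum]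
  exact sum_congr rfl fun j _ ↦ map_nsmul _ _ _

/-- The norm of an `F`-fixed element is `f` times it. [folklore] -/
theorem sum_pow_apply_of_apply_eq {P : M} (hP : F P = P) :
    ∑ j ∈ range f, (F ^ j) P = f • P := by
  have h : ∀ j, (F ^ j) P = P := fun j ↦ by
    induction j with
    | zero => exact pow_zero_apply F P
    | succ j ih => rw [pow_succ_apply, ih, hP]
  rw [sum_congr rfl fun j _ ↦ h j, sum_const, card_range]

/-! ### (C1) Torsion lifts of torus values -/

/-- **(C1) Torsion lift.**  If every torus value `s` with `(q^f - 1) s = 0` lifts to a point of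
`E0 ∩ L1` (`hlift`) and `K1 ∩ L1` is divisible by the good number `q^f - 1` (`hdiv`), then every
such `s` is `ρ Q` for some `Q ∈ E0 ∩ L1` with `(q^f - 1) Q = 0` (the unique prime-to-`p`
torsion point above a point of `Ẽ_ns(𝔽_{q^f}) = 𝔽_{q^f}^×`; Silverman, *AEC*, VII.3.1 for the
good-reduction analogue). [folklore] -/
theorem exists_torsion_lift (hK1 : K1 ≤ E0)
    (hρK : ∀ (P : M) (hP : P ∈ E0), ρ ⟨P, hP⟩ = 0 ↔ P ∈ K1)
    (hlift : ∀ s : A, (q ^ f - 1) • s = 0 → ∃ (U : M) (hU : U ∈ E0), U ∈ L1 ∧ ρ ⟨U, hU⟩ = s)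
    (hdiv : ∀ P ∈ K1, P ∈ L1 → ∃ Q ∈ K1, Q ∈ L1 ∧ (q ^ f - 1) • Q = P)
    (s : A) (hs : (q ^ f - 1) • s = 0) :
    ∃ (Q : M) (hQ : Q ∈ E0), Q ∈ L1 ∧ ρ ⟨Q, hQ⟩ = s ∧ (q ^ f - 1) • Q = 0 := by
  obtain ⟨U, hU, hUL, hρU⟩ := hlift s hs
  -- `(q^f - 1) U ∈ K1 ∩ L1`
  have hNU : (q ^ f - 1) • U ∈ E0 := E0.nsmul_mem hU _
  have hNUK : (q ^ f - 1) • U ∈ K1 := by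
    rw [← hρK _ hNU]
    have e : (⟨(q ^ f - 1) • U, hNU⟩ : E0) = (q ^ f - 1) • ⟨U, hU⟩ := rfl
    rw [e, map_nsmul, hρU, hs]
  obtain ⟨e, heK, heL, hNe⟩ := hdiv _ hNUK (L1.nsmul_mem hUL _)
  refine ⟨U - e, E0.sub_mem hU (hK1 heK), L1.sub_mem hUL heL, ?_, ?_⟩
  · have h0 : ρ ⟨e, hK1 heK⟩ = 0 := (hρK e (hK1 heK)).mpr heK
    have e' : (⟨U - e, E0.sub_mem hU (hK1 heK)⟩ : E0) = ⟨U, hU⟩ - ⟨e, hK1 heK⟩ := rfl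
    rw [e', map_sub, h0, sub_zero, hρU]
  · rw [nsmul_sub, hNe, sub_self]

/-! ### (C2) An `n`-torsion point in the class of `P₀` -/

/-- **(C2) `n`-torsion representatives of a component whose `n`-th multiple is trivial.**  Let
`P₀ ∈ L1` be `F`-fixed with `n P₀ ∈ E0`, `n` good.  If `q t = t` forces `t = n s` with
`(q^f - 1) s = 0` (`hR1`: `𝔽_q^× ⊆ (𝔽_{q^f}^×)^n`, which holds when `n ∣ f`), then there is an
`n`-torsion point `P' ∈ L1` with `P' - P₀ ∈ E0`.  (On the Tate curve: the unit part of the Tate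
parameter becomes an `n`-th power over the unramified extension of degree `f`, so the component
of `q^{1/n}` contains an `n`-torsion point.) [folklore] -/
theorem exists_nsmul_eq_zero_sub_mem (hK1 : K1 ≤ E0) (hFE : ∀ P ∈ E0, F P ∈ E0)
    (hρK : ∀ (P : M) (hP : P ∈ E0), ρ ⟨P, hP⟩ = 0 ↔ P ∈ K1)
    (hρF : ∀ (P : M) (hP : P ∈ E0), ρ ⟨F P, hFE P hP⟩ = q • ρ ⟨P, hP⟩)
    (hlift : ∀ s : A, (q ^ f - 1) • s = 0 → ∃ (U : M) (hU : U ∈ E0), U ∈ L1 ∧ ρ ⟨U, hU⟩ = s)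
    {n : ℕ} (hdiv : ∀ P ∈ K1, P ∈ L1 → ∃ Q ∈ K1, Q ∈ L1 ∧ n • Q = P)
    (hR1 : ∀ t : A, q • t = t → ∃ s : A, n • s = t ∧ (q ^ f - 1) • s = 0)
    {P₀ : M} (hP₀L : P₀ ∈ L1) (hP₀F : F P₀ = P₀) (hP₀n : n • P₀ ∈ E0) :
    ∃ P' : M, P' ∈ L1 ∧ n • P' = 0 ∧ P' - P₀ ∈ E0 ∧ P₀ - P' ∈ L1 := by
  -- `t = ρ (n P₀)` is `F`-fixed: `q t = t`
  set t : A := ρ ⟨n • P₀, hP₀n⟩ with ht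
  have hqt : q • t = t := by
    have hFn : F (n • P₀) = n • P₀ := by rw [map_nsmul, hP₀F]
    have e : (⟨F (n • P₀), hFE _ hP₀n⟩ : E0) = ⟨n • P₀, hP₀n⟩ := Subtype.ext hFn
    rw [ht, ← hρF _ hP₀n, e]
  obtain ⟨s, hns, hNs⟩ := hR1 t hqt
  obtain ⟨U, hU, hUL, hρU⟩ := hlift s hNs
  -- `D = n U - n P₀ ∈ K1 ∩ L1`
  have hD : n • U - n • P₀ ∈ E0 := E0.sub_mem (E0.nsmul_mem hU _) hP₀n
  have hDK : n • U - n • P₀ ∈ K1 := by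
    rw [← hρK _ hD]
    have e : (⟨n • U - n • P₀, hD⟩ : E0) = n • ⟨U, hU⟩ - ⟨n • P₀, hP₀n⟩ := rfl
    rw [e, map_sub, map_nsmul, hρU, hns, ← ht, sub_self]
  have hDL : n • U - n • P₀ ∈ L1 := L1.sub_mem (L1.nsmul_mem hUL _) (L1.nsmul_mem hP₀L _)
  obtain ⟨e, heK, heL, hne⟩ := hdiv _ hDK hDL
  -- `Y = U - e ∈ E0 ∩ L1`, `n Y = n P₀`; `P' = P₀ - Y`
  refine ⟨P₀ - (U - e), L1.sub_mem hP₀L (L1.sub_mem hUL heL), ?_, ?_, ?_⟩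
  · rw [nsmul_sub, nsmul_sub, hne]; abel
  · rw [show P₀ - (U - e) - P₀ = -(U - e) by abel]
    exact E0.neg_mem (E0.sub_mem hU (hK1 heK))
  · rw [show P₀ - (P₀ - (U - e)) = U - e by abel]
    exact L1.sub_mem hUL heL

/-! ### (C3) The norm-zero point -/

/-- **(C3) A norm-zero point of the layer in the class of `P₀`** — the algebraic skeleton of the
arithmetic half of Matsuno's Lemma 4.1.  Hypotheses: `K1 ≤ E0`; `E0`, `L1` are `F`-stable and
`Fᶠ = 1` on `L1`; `ρ : E0 → A` has kernel `K1` and `ρ ∘ F = q ρ`; torus values killed by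
`q^f - 1` lift to `E0 ∩ L1` (`hlift`); `K1 ∩ L1` is divisible by good numbers and `K1` has no
good torsion (`hdiv`, `htors`), good numbers being closed under products with `n` and `q^f - 1`
good; the two finite-field facts `hR1` (`n`-th roots, needs `n ∣ f`) and `hR2` (the norm
`u ↦ Σ_{j<f} qʲ u` maps the `(q^f-1)`-torsion onto the `q`-fixed elements); and `P₀ ∈ L1`
`F`-fixed with `n P₀ ∈ E0`, `n ∣ f`.  Conclusion: **there is `m ∈ L1` with `Σ_{j<f} Fʲ m = 0`
and `m - P₀ ∈ E0`.**  This replaces the appeal to `H¹(G₀, E₀(L)) = 0` /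
`Ĥ⁰(G₀, E₀(L)) = 0` (Mazur 1972, Prop. 4.3) in the printed proof.
[cite: Matsuno2009, Lemma 4.1 (proof, p. 454)] -/
theorem exists_sum_pow_apply_eq_zero_sub_mem (hK1 : K1 ≤ E0) (hFE : ∀ P ∈ E0, F P ∈ E0)
    (hFL : ∀ P ∈ L1, F P ∈ L1) (hFf : ∀ P ∈ L1, (F ^ f) P = P)
    (hρK : ∀ (P : M) (hP : P ∈ E0), ρ ⟨P, hP⟩ = 0 ↔ P ∈ K1)
    (hρF : ∀ (P : M) (hP : P ∈ E0), ρ ⟨F P, hFE P hP⟩ = q • ρ ⟨P, hP⟩)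
    (hlift : ∀ s : A, (q ^ f - 1) • s = 0 → ∃ (U : M) (hU : U ∈ E0), U ∈ L1 ∧ ρ ⟨U, hU⟩ = s)
    {IsGood : ℕ → Prop}
    (hdiv : ∀ N, IsGood N → ∀ P ∈ K1, P ∈ L1 → ∃ Q ∈ K1, Q ∈ L1 ∧ N • Q = P)
    (htors : ∀ N, IsGood N → ∀ P ∈ K1, N • P = 0 → P = 0)
    (hmul : ∀ a b, IsGood a → IsGood b → IsGood (a * b)) {n : ℕ} (hn : IsGood n)
    (hN : IsGood (q ^ f - 1))
    (hR1 : ∀ t : A, q • t = t → ∃ s : A, n • s = t ∧ (q ^ f - 1) • s = 0)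
    (hR2 : ∀ t : A, q • t = t → n • t = 0 →
      ∃ u : A, (q ^ f - 1) • u = 0 ∧ ∑ j ∈ range f, q ^ j • u = t)
    (hnf : n ∣ f) {P₀ : M} (hP₀L : P₀ ∈ L1) (hP₀F : F P₀ = P₀) (hP₀n : n • P₀ ∈ E0) :
    ∃ m : M, m ∈ L1 ∧ ∑ j ∈ range f, (F ^ j) m = 0 ∧ m - P₀ ∈ E0 := by
  -- (C2): an `n`-torsion point `P'` in the class of `P₀`
  obtain ⟨P', hP'L, hnP', hP'P₀, -⟩ := exists_nsmul_eq_zero_sub_mem hK1 hFE hρK hρF hlift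
    (hdiv n hn) hR1 hP₀L hP₀F hP₀n
  -- its norm `T`
  set T : M := ∑ j ∈ range f, (F ^ j) P' with hTdef
  have hTF : F T = T := apply_sum_pow_apply_eq (hFf P' hP'L)
  have hnT : n • T = 0 := by rw [hTdef, ← sum_pow_apply_nsmul, hnP']; simp
  have hTL : T ∈ L1 := L1.sum_mem fun j _ ↦ pow_apply_mem hFL j hP'L
  -- `T ∈ E0`: `T = Σ Fʲ (P' - P₀) + f P₀` and `f P₀ = (f/n) (n P₀)`
  have hTE : T ∈ E0 := by
    obtain ⟨k, hk⟩ := hnf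
    have hfP₀ : f • P₀ ∈ E0 := by
      rw [hk, mul_nsmul]
      exact E0.nsmul_mem hP₀n k
    have hsum : ∑ j ∈ range f, (F ^ j) (P' - P₀) ∈ E0 :=
      E0.sum_mem fun j _ ↦ pow_apply_mem hFE j hP'P₀
    have e : T = ∑ j ∈ range f, (F ^ j) (P' - P₀) + f • P₀ := by
      rw [sum_pow_apply_sub, sum_pow_apply_of_apply_eq hP₀F, sub_add_cancel]
    rw [e]
    exact E0.add_mem hsum hfP₀
  -- the torus value `t' = ρ T`: `q t' = t'`, `n t' = 0`
  set t' : A := ρ ⟨T, hTE⟩ with ht'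
  have hqt' : q • t' = t' := by
    have e : (⟨F T, hFE _ hTE⟩ : E0) = ⟨T, hTE⟩ := Subtype.ext hTF
    rw [ht', ← hρF _ hTE, e]
  have hnt' : n • t' = 0 := by
    have e : n • (⟨T, hTE⟩ : E0) = ⟨n • T, E0.nsmul_mem hTE n⟩ := rfl
    rw [ht', ← map_nsmul, e]
    have e0 : (⟨n • T, E0.nsmul_mem hTE n⟩ : E0) = 0 := Subtype.ext hnT
    rw [e0, map_zero]
  -- `t' = Σ qʲ u`, `u` a `(q^f - 1)`-torsion torus value, lifted to a torsion point `Q`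
  obtain ⟨u, hNu, hsum_u⟩ := hR2 t' hqt' hnt'
  obtain ⟨Q, hQ, hQL, hρQ, hNQ⟩ := exists_torsion_lift hK1 hρK hlift (hdiv _ hN) u hNu
  -- the norm of `Q` has torus value `t'`
  have hNQE : ∑ j ∈ range f, (F ^ j) Q ∈ E0 := E0.sum_mem fun j _ ↦ pow_apply_mem hFE j hQ
  have hρNQ : ρ ⟨∑ j ∈ range f, (F ^ j) Q, hNQE⟩ = t' := by
    have e : (⟨∑ j ∈ range f, (F ^ j) Q, hNQE⟩ : E0) =
        ∑ j ∈ range f, (⟨(F ^ j) Q, pow_apply_mem hFE j hQ⟩ : E0) := by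
      apply Subtype.ext
      rw [AddSubgroup.val_finsetSum]
    rw [e, map_sum, ← hsum_u]
    exact sum_congr rfl fun j _ ↦ by rw [rho_pow_apply hFE hρF j Q hQ, hρQ]
  -- `Σ Fʲ Q - T ∈ K1` is killed by the good `(q^f - 1) n`, hence is `0`
  have hdiffE : ∑ j ∈ range f, (F ^ j) Q - T ∈ E0 := E0.sub_mem hNQE hTE
  have hdiffK : ∑ j ∈ range f, (F ^ j) Q - T ∈ K1 := by
    rw [← hρK _ hdiffE]
    have e : (⟨∑ j ∈ range f, (F ^ j) Q - T, hdiffE⟩ : E0) =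
        ⟨∑ j ∈ range f, (F ^ j) Q, hNQE⟩ - ⟨T, hTE⟩ := rfl
    rw [e, map_sub, hρNQ, ← ht', sub_self]
  have hkill : ((q ^ f - 1) * n) • (∑ j ∈ range f, (F ^ j) Q - T) = 0 := by
    have h1 : ((q ^ f - 1) * n) • T = 0 := by rw [mul_nsmul', hnT, smul_zero]
    have h2 : ((q ^ f - 1) * n) • ∑ j ∈ range f, (F ^ j) Q = 0 := by
      rw [mul_nsmul, ← sum_pow_apply_nsmul, hNQ]
      simp
    rw [nsmul_sub, h1, h2, sub_zero]
  have hzero : ∑ j ∈ range f, (F ^ j) Q - T = 0 :=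
    htors _ (hmul _ _ hN hn) _ hdiffK hkill
  -- `m = P' - Q`
  refine ⟨P' - Q, L1.sub_mem hP'L hQL, ?_, ?_⟩
  · rw [sum_pow_apply_sub, ← hTdef]
    rw [sub_eq_zero] at hzero
    rw [hzero, sub_self]
  · rw [show P' - Q - P₀ = (P' - P₀) - Q by abel]
    exact E0.sub_mem hP'P₀ hQ

end Literature.NumberTheory.EllipticCurves.NormZeroSkeleton
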